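import Summits.BirchSwinnertonDyer.BirchSwinnertonDyer.Theorems.EdixhovenFibreFiveSevenKatoNeronTwistedSymbolSumIntegrality
import Literature.NumberTheory.EllipticCurves.KatoAdditiveTwistedValueNeronIntegralityFiveSeven
import Literature.NumberTheory.EllipticCurves.KatoAdditiveTwistedValueNeronIntegralityThree
import Literature.NumberTheory.EllipticCurves.KatoAdditiveTwistedValueNeronIntegralityThreeKP
import HarnessLib

/-!
# The sibling Kato–Néron facts DISCHARGED: `p > 7`, `p ∈ {5,7}` polar, `p = 3` polar, `p = 3`
# Kosters–Pannekoek-indexed, and the quadratic `ord_p`-form — all by the elementary reversal at every `p ≥ 3`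

Route `EdixhovenFibreFiveSeven` (cell `pub/bsd-wall`, seat `bsd-line-edix-p1` g43); companion of
`EdixhovenFibreFiveSevenKatoNeronTwistedSymbolSumIntegrality.lean` (p829166: F″ =
`kato_neron_isIntegral_twistedSymbolSum_of_additive_five_le` discharged).  The road of that file — cusps
`a/m ~ 0` for `gcd(m,N) = 1`, `re/im Λ_f = ℤ·Ω^±_f/2`, `p ∤ c₀` for `p ≥ 3`
(`not_dvd_maninConstant_of_three_le`, UDC-dependent), prime-to-`p` period transfer under irreducibility —
uses of `p` only `p ≠ 2`.  Here the two clauses are restated at every prime `p ≥ 3`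
(`even_clause_of_three_le`, `odd_clause_of_three_le`) and the following Literature named facts (all
cite-only until now, «size XL: Kato's explicit reciprocity law / Kosters–Pannekoek receptacle») are
DISCHARGED as typed — each is F″'s body under a different side clause, and every side clause is idle:

* `kato_neron_isIntegral_twistedSymbolSum_of_additive_holds` (`p > 7`, all characters of order prime to `p`);
* `kato_neron_isIntegral_twistedSymbolSum_of_additive_five_seven_polar_holds` (`p ∈ {5,7}`, polar clause);
* `kato_neron_isIntegral_twistedSymbolSum_of_additive_three_polar_holds` (`p = 3`, `χ(3) ≠ ±1`);
* `kato_neron_isIntegral_twistedSymbolSum_of_additive_three_kp_holds` (`p = 3`, `χ(3)·ā(V) ≠ 1`);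
* `kato_neron_padicValRat_twistedSymbolSum_nonneg_of_additive_holds` (`p > 7`, quadratic `χ`, `r ∈ ℚ`,
  one-sided Euler factor, conclusion `0 ≤ ord_p(ϖ r)`; rational descent of an algebraic integer).

HONEST STATUS.  Kernel-closed, UDC-dependent (through `not_dvd_maninConstant_of_three_le`), audit (P†)
pending.  As typed these facts are statements about `Λ_f`-periods transferred to Néron periods; Kato's Euler
system is not formalised.  BSD is proved for no curve; Manin's conjecture is not announced.
-/

set_option autoImplicit false
-- the Theorems namespace of this sub repeats the summit name by design (D-0017 nested layout)
set_option linter.dupNamespace false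

noncomputable section

open scoped Classical MatrixGroups ModularForm

open CongruenceSubgroup Complex WeierstrassCurve Literature.NumberTheory.EllipticCurves
  Literature.NumberTheory.EllipticCurves.ModularForms

namespace Summit.BirchSwinnertonDyer.BirchSwinnertonDyer.Theorems

namespace KatoNeronTwistedSymbolSum

/-! ### §1 The two clauses at every prime `p ≥ 3` -/

/-- **Even clause at every prime `p ≥ 3` with `E[p]` irreducible**: `V/ℚ` globally minimal with newform
`f ∈ S₂(Γ₀(N))`, `m` prime to `N`, `χ ≠ 1` even mod `m`, `ϖ·Ω(V) = Ω⁺_f`, `E·Σ_a χ(a){∞,a/m}_f = r·Ω⁺_f`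
⟹ `s·ϖ·r` is an algebraic integer for some `p ∤ s` (proof = `even_clause` with `p ≠ 2` the only use of `p`).
[cite: GreenbergVatsal2000, §3, Remark 3.4] [cite: MazurTateTeitelbaum1986, §I.8] -/
theorem even_clause_of_three_le (V : WeierstrassCurve ℚ) [V.IsElliptic] [V.IsGloballyMinimal] {N : ℕ}
    [NeZero N] (f : CuspForm (Gamma0 N) 2) (hf : IsNewformOf V f) (p : ℕ) [Fact p.Prime] (hp3 : 3 ≤ p)
    (hirr : V.HasIrreducibleModPGaloisRep p) {m : ℕ} [NeZero m] (hNm : IsCoprime (N : ℤ) m)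
    (χ : DirichletCharacter ℂ m) (hχ : χ.Even) (hχ1 : χ ≠ 1) (ϖ : ℚ) (r : ℂ)
    (hϖ : (ϖ : ℝ) * V.realPeriodRat = plusPeriod f)
    (hr : (∏ ℓ ∈ N.primeFactors with ¬ ℓ ^ 2 ∣ N,
        (((ℓ : ℂ) - (V.LFunction ℓ : ℂ) * χ (ℓ : ZMod m)) *
          ((ℓ : ℂ) - (V.LFunction ℓ : ℂ) * (χ (ℓ : ZMod m))⁻¹))) *
        twistedSymbolSum f χ = r * (plusPeriod f : ℂ)) :
    ∃ s : ℕ, ¬ p ∣ s ∧ IsIntegral ℤ ((s : ℂ) * ϖ * r) := by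
  have hp2 : p ≠ 2 := by omega
  have hQ : coeffField f = ⊥ := hf.coeffField_eq_bot
  obtain ⟨k, hk, htss⟩ := exists_isIntegral_twistedSymbolSum_eq_of_even f hf.1 hQ hNm χ hχ hχ1
  have hΩ : (plusPeriod f : ℂ) ≠ 0 := by exact_mod_cast (IsNewform0.plusPeriod_pos_holds hf.1 hQ).ne'
  set E : ℂ := ∏ ℓ ∈ N.primeFactors with ¬ ℓ ^ 2 ∣ N,
        (((ℓ : ℂ) - (V.LFunction ℓ : ℂ) * χ (ℓ : ZMod m)) *
          ((ℓ : ℂ) - (V.LFunction ℓ : ℂ) * (χ (ℓ : ZMod m))⁻¹)) with hE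
  have hEint : IsIntegral ℤ E := isIntegral_eulerDepletion χ (fun ℓ ↦ V.LFunction ℓ) _
  have h2r : 2 * r = E * k := by
    have h1 : r * (plusPeriod f : ℂ) = (E * k / 2) * (plusPeriod f : ℂ) := by
      rw [← hr, htss]; push_cast; ring
    have h2 := mul_right_cancel₀ hΩ h1
    rw [h2]; ring
  have hc : ∀ (W₀ : WeierstrassCurve ℚ) [W₀.IsElliptic] [W₀.IsGloballyMinimal]
      (D₀ : ModularParametrizationData W₀ N), D₀.f = f →
      (∀ z ∈ D₀.L.lattice, ∃ w ∈ periodLattice D₀.f, z = D₀.c * w) → ¬ (p : ℤ) ∣ D₀.maninConstant :=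
    fun W₀ _ _ D₀ _ hopt ↦ not_dvd_maninConstant_of_three_le W₀ D₀ hopt hp3
  obtain ⟨u, hu, hΩu⟩ := SkinnerUrban2014.exists_unit_mul_plusPeriod_of_irreducible V p hp2 hirr f hf hc
  have hval : padicValRat p ϖ = 0 :=
    Rank1Residual.padicValRat_periodRatio_eq_zero_of_eq_unit_mul V p f hu hΩu ϖ hϖ
  exact exists_not_dvd_isIntegral_mul hp2 hval (hEint.mul hk) h2r

/-- **Odd clause at every prime `p ≥ 3` with `E[p]` irreducible**: `V/ℚ` globally minimal with newform `f`,
`m` prime to `N`, `χ` odd mod `m`, `ϖ·|Ω⁻(V)| = Ω⁻_f`, `E·Σ_a χ(a){∞,a/m}_f = r·Ω⁻_f·i` ⟹ `s·ϖ·r` is an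
algebraic integer for some `p ∤ s`. [cite: GreenbergVatsal2000, §3, Remark 3.4] [cite: MazurTateTeitelbaum1986, §I.8] -/
theorem odd_clause_of_three_le (V : WeierstrassCurve ℚ) [V.IsElliptic] [V.IsGloballyMinimal] {N : ℕ}
    [NeZero N] (f : CuspForm (Gamma0 N) 2) (hf : IsNewformOf V f) (p : ℕ) [Fact p.Prime] (hp3 : 3 ≤ p)
    (hirr : V.HasIrreducibleModPGaloisRep p) {m : ℕ} [NeZero m] (hNm : IsCoprime (N : ℤ) m)
    (χ : DirichletCharacter ℂ m) (hχ : χ.Odd) (ϖ : ℚ) (r : ℂ)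
    (hϖ : (ϖ : ℝ) * V.imaginaryPeriodRat = minusPeriod f)
    (hr : (∏ ℓ ∈ N.primeFactors with ¬ ℓ ^ 2 ∣ N,
        (((ℓ : ℂ) - (V.LFunction ℓ : ℂ) * χ (ℓ : ZMod m)) *
          ((ℓ : ℂ) - (V.LFunction ℓ : ℂ) * (χ (ℓ : ZMod m))⁻¹))) *
        twistedSymbolSum f χ = r * (minusPeriod f : ℂ) * Complex.I) :
    ∃ s : ℕ, ¬ p ∣ s ∧ IsIntegral ℤ ((s : ℂ) * ϖ * r) := by
  have hp2 : p ≠ 2 := by omega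
  have hQ : coeffField f = ⊥ := hf.coeffField_eq_bot
  obtain ⟨k, hk, htss⟩ := exists_isIntegral_twistedSymbolSum_eq_of_odd f hf.1 hQ hNm χ hχ
  have hΩ : (minusPeriod f : ℂ) ≠ 0 := by exact_mod_cast (IsNewform0.minusPeriod_pos_holds hf.1 hQ).ne'
  set E : ℂ := ∏ ℓ ∈ N.primeFactors with ¬ ℓ ^ 2 ∣ N,
        (((ℓ : ℂ) - (V.LFunction ℓ : ℂ) * χ (ℓ : ZMod m)) *
          ((ℓ : ℂ) - (V.LFunction ℓ : ℂ) * (χ (ℓ : ZMod m))⁻¹)) with hE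
  have hEint : IsIntegral ℤ E := isIntegral_eulerDepletion χ (fun ℓ ↦ V.LFunction ℓ) _
  have h2r : 2 * r = E * k := by
    have hΩI : (minusPeriod f : ℂ) * I ≠ 0 := mul_ne_zero hΩ I_ne_zero
    have h1 : r * ((minusPeriod f : ℂ) * I) = (E * k / 2) * ((minusPeriod f : ℂ) * I) := by
      rw [← mul_assoc, ← hr, htss]; push_cast; ring
    have h2 := mul_right_cancel₀ hΩI h1
    rw [h2]; ring
  have hc : ∀ (W₀ : WeierstrassCurve ℚ) [W₀.IsElliptic] [W₀.IsGloballyMinimal]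
      (D₀ : ModularParametrizationData W₀ N), D₀.f = f →
      (∀ z ∈ D₀.L.lattice, ∃ w ∈ periodLattice D₀.f, z = D₀.c * w) → ¬ (p : ℤ) ∣ D₀.maninConstant :=
    fun W₀ _ _ D₀ _ hopt ↦ not_dvd_maninConstant_of_three_le W₀ D₀ hopt hp3
  obtain ⟨u, hu, hΩu⟩ := SkinnerUrban2014.exists_unit_mul_minusPeriod_of_irreducible V p hp2 hirr f hf hc
  have hval : padicValRat p ϖ = 0 := padicValRat_minusPeriodRatio_eq_zero_of_eq_unit_mul V p f hu hΩu ϖ hϖ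
  exact exists_not_dvd_isIntegral_mul hp2 hval (hEint.mul hk) h2r

/-- `m` prime to `p·N` is prime to `N` (bookkeeping for the facts' binder `m.Coprime (p * N)`). [folklore] -/
theorem isCoprime_level_of_coprime_mul {m p N : ℕ} (hm : m.Coprime (p * N)) : IsCoprime (N : ℤ) m :=
  Nat.isCoprime_iff_coprime.mpr (Nat.Coprime.coprime_dvd_right (Dvd.intro_left p rfl) hm).symm

/-! ### §2 Rational descent for the quadratic form -/

/-- If `s·q` (`q ∈ ℚ`, `s ∈ ℕ`, `p ∤ s`) is an algebraic integer then `ord_p q ≥ 0` (an algebraic integer in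
`ℚ` is in `ℤ`: `ℤ` is integrally closed). [folklore] -/
theorem padicValRat_nonneg_of_isIntegral_natCast_mul {p : ℕ} [hp : Fact p.Prime] {q : ℚ} {s : ℕ}
    (hs : ¬ p ∣ s) (h : IsIntegral ℤ ((s : ℂ) * (q : ℂ))) : 0 ≤ padicValRat p q := by
  by_cases hq : q = 0
  · rw [hq, padicValRat.zero]
  have hs0 : s ≠ 0 := fun h0 ↦ hs (h0 ▸ dvd_zero p)
  -- descend to `ℚ`
  have h' : IsIntegral ℤ ((s : ℚ) * q) := by
    have e : (algebraMap ℚ ℂ) ((s : ℚ) * q) = (s : ℂ) * (q : ℂ) := by push_cast; rfl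
    exact (isIntegral_algHom_iff (IsScalarTower.toAlgHom ℤ ℚ ℂ) (algebraMap ℚ ℂ).injective).mp (e ▸ h)
  obtain ⟨z, hz⟩ := IsIntegrallyClosed.isIntegral_iff.mp h'
  have hzq : (z : ℚ) = (s : ℚ) * q := by simpa using hz
  have hs' : padicValRat p (s : ℚ) = 0 := by
    rw [padicValRat.of_nat, padicValNat.eq_zero_of_not_dvd hs, Nat.cast_zero]
  have hsq : padicValRat p ((s : ℚ) * q) = padicValRat p q := by
    rw [padicValRat.mul (by exact_mod_cast hs0) hq, hs', zero_add]
  rw [← hsq, ← hzq, padicValRat.of_int]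
  exact_mod_cast Nat.zero_le _

/-- Values of a quadratic character are their own inverses (`χ(a) ∈ {0, ±1}`), so the one-sided Euler factor of
the quadratic fact is an algebraic integer. [folklore] -/
theorem isIntegral_eulerDepletion_oneSided {m : ℕ} [NeZero m] (χ : DirichletCharacter ℂ m) (a : ℕ → ℤ)
    (S : Finset ℕ) :
    IsIntegral ℤ (∏ ℓ ∈ S, ((ℓ : ℂ) - (a ℓ : ℂ) * χ (ℓ : ZMod m))) :=
  IsIntegral.prod _ fun ℓ _ ↦ (isIntegral_algebraMap (R := ℤ) (x := (ℓ : ℤ))).sub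
    ((isIntegral_algebraMap (R := ℤ) (x := a ℓ)).mul (ManinLocalTwoThree.DirichletCharacter.isIntegral_apply χ _))

/-- `ord_p(ϖ·r) ≥ 0` from `ord_p ϖ = 0` and `2r` a (complex) algebraic integer with `r ∈ ℚ`, `p` odd. [folklore] -/
theorem padicValRat_mul_nonneg_of_two_mul_eq {p : ℕ} [hp : Fact p.Prime] (hp2 : p ≠ 2) {ϖ r : ℚ}
    (hϖ : padicValRat p ϖ = 0) {t : ℂ} (ht : IsIntegral ℤ t) (hr : 2 * (r : ℂ) = t) :
    0 ≤ padicValRat p (ϖ * r) := by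
  have h2 : ¬ p ∣ 2 := fun h ↦ hp2 ((Nat.prime_dvd_prime_iff_eq hp.out Nat.prime_two).mp h)
  have hr' : 0 ≤ padicValRat p r :=
    padicValRat_nonneg_of_isIntegral_natCast_mul h2 (by rw [Nat.cast_ofNat, hr]; exact ht)
  by_cases hr0 : r = 0
  · rw [hr0, mul_zero, padicValRat.zero]
  by_cases hϖ0 : ϖ = 0
  · rw [hϖ0, zero_mul, padicValRat.zero]
  rw [padicValRat.mul hϖ0 hr0, hϖ, zero_add]
  exact hr'

end KatoNeronTwistedSymbolSum

open KatoNeronTwistedSymbolSum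

/-! ### §3 The named facts -/

/-- **`kato_neron_isIntegral_twistedSymbolSum_of_additive` holds** (the `p > 7`, all-characters form; Kato 2004
(8.1.3)/9.7/6.6 + Kim–Nakamura 2020 §2 as typed): F″'s body with `7 < p`; by the clauses at `p ≥ 3`.
UDC-dependent; BSD is not proved by this. [cite: Kato2004Asterisque, (8.1.3) (p. 180), Thm. 9.7 (p. 189), Thm. 6.6 (1) (p. 163)]
[cite: KimNakamura2020, Cor. 2.4] [cite: GreenbergVatsal2000, §3, Remark 3.4] -/
theorem kato_neron_isIntegral_twistedSymbolSum_of_additive_holds :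
    kato_neron_isIntegral_twistedSymbolSum_of_additive := by
  intro V _ _ N _ f hf p _ hp7 _ _ hirr m _ hm χ _ hχ1 _ ϖ r
  have hNm : IsCoprime (N : ℤ) m := isCoprime_level_of_coprime_mul hm
  exact ⟨fun hev hϖ hr ↦ even_clause_of_three_le V f hf p (by omega) hirr hNm χ hev hχ1 ϖ r hϖ hr,
    fun hodd hϖ hr ↦ odd_clause_of_three_le V f hf p (by omega) hirr hNm χ hodd ϖ r hϖ hr⟩

/-- **`kato_neron_isIntegral_twistedSymbolSum_of_additive_five_seven_polar` holds** (`p ∈ {5,7}`, polar clause —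
idle). UDC-dependent; BSD is not proved by this. [cite: Kato2004Asterisque, (8.1.3) (p. 180), Thm. 9.7 (p. 189)]
[cite: KostersPannekoek2017, §3.3.1] [cite: GreenbergVatsal2000, §3, Remark 3.4] -/
theorem kato_neron_isIntegral_twistedSymbolSum_of_additive_five_seven_polar_holds :
    kato_neron_isIntegral_twistedSymbolSum_of_additive_five_seven_polar := by
  intro V _ _ N _ f hf p _ hp57 _ _ hirr m _ hm χ _ hχ1 _ _ ϖ r
  have hNm : IsCoprime (N : ℤ) m := isCoprime_level_of_coprime_mul hm
  have hp3 : 3 ≤ p := by rcases hp57 with rfl | rfl <;> norm_num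
  exact ⟨fun hev hϖ hr ↦ even_clause_of_three_le V f hf p hp3 hirr hNm χ hev hχ1 ϖ r hϖ hr,
    fun hodd hϖ hr ↦ odd_clause_of_three_le V f hf p hp3 hirr hNm χ hodd ϖ r hϖ hr⟩

/-- **`kato_neron_isIntegral_twistedSymbolSum_of_additive_three_polar` holds** (`p = 3`, `χ(3) ≠ ±1` — idle):
`3 ∤ c₀` at every level is the `p = 3` case of `not_dvd_maninConstant_of_three_le`. UDC-dependent; BSD is not
proved by this. [cite: Kato2004Asterisque, (8.1.3) (p. 180), Thm. 9.7 (p. 189)] [cite: KostersPannekoek2017, §3.3.1]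
[cite: GreenbergVatsal2000, §3, Remark 3.4] -/
theorem kato_neron_isIntegral_twistedSymbolSum_of_additive_three_polar_holds :
    kato_neron_isIntegral_twistedSymbolSum_of_additive_three_polar := by
  intro V _ _ N _ f hf _ _ hirr m _ hm χ _ hχ1 _ _ _ ϖ r
  haveI : Fact (Nat.Prime 3) := ⟨Nat.prime_three⟩
  have hNm : IsCoprime (N : ℤ) m := isCoprime_level_of_coprime_mul hm
  exact ⟨fun hev hϖ hr ↦ even_clause_of_three_le V f hf 3 le_rfl hirr hNm χ hev hχ1 ϖ r hϖ hr,
    fun hodd hϖ hr ↦ odd_clause_of_three_le V f hf 3 le_rfl hirr hNm χ hodd ϖ r hϖ hr⟩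

/-- **`kato_neron_isIntegral_twistedSymbolSum_of_additive_three_kp` holds** (`p = 3`, Kosters–Pannekoek-indexed
clause `χ(3)·ā(V) ≠ 1` — idle). UDC-dependent; BSD is not proved by this.
[cite: Kato2004Asterisque, (8.1.3) (p. 180), Thm. 9.7 (p. 189)] [cite: KostersPannekoek2017, Thm. 1 (ii)]
[cite: GreenbergVatsal2000, §3, Remark 3.4] -/
theorem kato_neron_isIntegral_twistedSymbolSum_of_additive_three_kp_holds :
    kato_neron_isIntegral_twistedSymbolSum_of_additive_three_kp := by
  intro V _ _ N _ f hf _ _ hirr m _ hm χ _ hχ1 _ _ ϖ r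
  haveI : Fact (Nat.Prime 3) := ⟨Nat.prime_three⟩
  have hNm : IsCoprime (N : ℤ) m := isCoprime_level_of_coprime_mul hm
  exact ⟨fun hev hϖ hr ↦ even_clause_of_three_le V f hf 3 le_rfl hirr hNm χ hev hχ1 ϖ r hϖ hr,
    fun hodd hϖ hr ↦ odd_clause_of_three_le V f hf 3 le_rfl hirr hNm χ hodd ϖ r hϖ hr⟩

/-- **`kato_neron_padicValRat_twistedSymbolSum_nonneg_of_additive` holds** (the original quadratic form: `p > 7`,
`χ` primitive quadratic, `r ∈ ℚ`, ONE-SIDED Euler factor `∏_{ℓ∥N}(ℓ − a_ℓχ(ℓ))`, conclusion `0 ≤ ord_p(ϖ·r)`):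
`Σ_a χ(a){∞,a/m}_f = k·Ω^±_f/2` (`·i`) with `k` an algebraic integer, so `2r = E·k` is an algebraic integer in
`ℚ`, i.e. in `ℤ[1/1]`; `ord_p ϖ = 0`; `p` odd. UDC-dependent; BSD is not proved by this.
[cite: Kato2004Asterisque, (8.1.3) (p. 180), Thm. 9.7 (p. 189), Thm. 6.6 (1) (p. 163)] [cite: KimNakamura2020, Cor. 2.4]
[cite: MazurTateTeitelbaum1986, §I.8 (8.6)] -/
theorem kato_neron_padicValRat_twistedSymbolSum_nonneg_of_additive_holds :
    kato_neron_padicValRat_twistedSymbolSum_nonneg_of_additive := by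
  intro V _ _ N _ f hf p _ hp7 _ _ hirr m _ hm χ _ hχ1 _ ϖ r
  have hNm : IsCoprime (N : ℤ) m := isCoprime_level_of_coprime_mul hm
  have hp2 : p ≠ 2 := by omega
  have hp3 : 3 ≤ p := by omega
  have hQ : coeffField f = ⊥ := hf.coeffField_eq_bot
  have hc : ∀ (W₀ : WeierstrassCurve ℚ) [W₀.IsElliptic] [W₀.IsGloballyMinimal]
      (D₀ : ModularParametrizationData W₀ N), D₀.f = f →
      (∀ z ∈ D₀.L.lattice, ∃ w ∈ periodLattice D₀.f, z = D₀.c * w) → ¬ (p : ℤ) ∣ D₀.maninConstant :=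
    fun W₀ _ _ D₀ _ hopt ↦ not_dvd_maninConstant_of_three_le W₀ D₀ hopt hp3
  have hEint : IsIntegral ℤ (∏ ℓ ∈ N.primeFactors with ¬ ℓ ^ 2 ∣ N,
      ((ℓ : ℂ) - (V.LFunction ℓ : ℂ) * χ (ℓ : ZMod m))) :=
    isIntegral_eulerDepletion_oneSided χ (fun ℓ ↦ V.LFunction ℓ) _
  refine ⟨fun hev hϖ hr ↦ ?_, fun hodd hϖ hr ↦ ?_⟩
  · obtain ⟨k, hk, htss⟩ := exists_isIntegral_twistedSymbolSum_eq_of_even f hf.1 hQ hNm χ hev hχ1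
    have hΩ : (plusPeriod f : ℂ) ≠ 0 := by exact_mod_cast (IsNewform0.plusPeriod_pos_holds hf.1 hQ).ne'
    have h2r : 2 * (r : ℂ) = (∏ ℓ ∈ N.primeFactors with ¬ ℓ ^ 2 ∣ N,
        ((ℓ : ℂ) - (V.LFunction ℓ : ℂ) * χ (ℓ : ZMod m))) * k := by
      have h1 : (r : ℂ) * (plusPeriod f : ℂ) = ((∏ ℓ ∈ N.primeFactors with ¬ ℓ ^ 2 ∣ N,
          ((ℓ : ℂ) - (V.LFunction ℓ : ℂ) * χ (ℓ : ZMod m))) * k / 2) * (plusPeriod f : ℂ) := by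
        rw [← hr, htss]; push_cast; ring
      have h2 := mul_right_cancel₀ hΩ h1
      rw [h2]; ring
    obtain ⟨u, hu, hΩu⟩ := SkinnerUrban2014.exists_unit_mul_plusPeriod_of_irreducible V p hp2 hirr f hf hc
    have hval : padicValRat p ϖ = 0 :=
      Rank1Residual.padicValRat_periodRatio_eq_zero_of_eq_unit_mul V p f hu hΩu ϖ hϖ
    exact padicValRat_mul_nonneg_of_two_mul_eq hp2 hval (hEint.mul hk) h2r
  · obtain ⟨k, hk, htss⟩ := exists_isIntegral_twistedSymbolSum_eq_of_odd f hf.1 hQ hNm χ hodd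
    have hΩ : (minusPeriod f : ℂ) ≠ 0 := by exact_mod_cast (IsNewform0.minusPeriod_pos_holds hf.1 hQ).ne'
    have hΩI : (minusPeriod f : ℂ) * I ≠ 0 := mul_ne_zero hΩ I_ne_zero
    have h2r : 2 * (r : ℂ) = (∏ ℓ ∈ N.primeFactors with ¬ ℓ ^ 2 ∣ N,
        ((ℓ : ℂ) - (V.LFunction ℓ : ℂ) * χ (ℓ : ZMod m))) * k := by
      have h1 : (r : ℂ) * ((minusPeriod f : ℂ) * I) = ((∏ ℓ ∈ N.primeFactors with ¬ ℓ ^ 2 ∣ N,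
          ((ℓ : ℂ) - (V.LFunction ℓ : ℂ) * χ (ℓ : ZMod m))) * k / 2) * ((minusPeriod f : ℂ) * I) := by
        rw [← mul_assoc, ← hr, htss]; push_cast; ring
      have h2 := mul_right_cancel₀ hΩI h1
      rw [h2]; ring
    obtain ⟨u, hu, hΩu⟩ := SkinnerUrban2014.exists_unit_mul_minusPeriod_of_irreducible V p hp2 hirr f hf hc
    have hval : padicValRat p ϖ = 0 :=
      padicValRat_minusPeriodRatio_eq_zero_of_eq_unit_mul V p f hu hΩu ϖ hϖ
    exact padicValRat_mul_nonneg_of_two_mul_eq hp2 hval (hEint.mul hk) h2r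

end Summit.BirchSwinnertonDyer.BirchSwinnertonDyer.Theorems

end
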